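import Literature.Geometry.DiscreteGeometry.KissingCertComp
import HarnessLib

/-!
# Certificate format and kernel-evaluable checker for the three-point bound on `S²` (Tammes / `A(3, θ)`)

The `n = 3` sibling of `KissingCertComp` (which is the `n = 4`, `s = 1/2` checker behind `k(4) = 24`):
plain `List`/`ℤ` programs on the sparse term lists `SPoly` of `PolyCert`, evaluated by the kernel (`decide`),
for certificates of the Bachoc–Vallentin three-point bound on `S²` (BV 2008, Theorem 4.2 with `n = 3`)
at an ARBITRARY rational angle cosine `s = p/q` and degree `d`:
«every finite set of unit vectors of `ℝ³` with pairwise inner products `≤ p/q` has at most `12` elements»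
(`T13(arccos(p/q))`, the "SDP top cut" of the sticky-sphere crystallization programme).

What changes with respect to `KissingCertComp`:
* the two-point part is `A(u) = Σ_{k=1}^{d} a_k P_k(u)` with LEGENDRE `P_k` (Schoenberg on `S²`), reflected as
  `APoly3 d as = Σ_k as[k-1]·2^{d-k}·(2^k P_k)` via `legendreIPoly k U (C 1) = 2^k P_k ∈ ℤ[u]`;
* the three-point kernel is `Q3 k (u,v,t) = chebHom k (2(t-uv)) ((1-u²)(1-v²))` (the tree's
  `BachocVallentin.Q3`, Chebyshev of the FIRST kind, inner sphere `S¹`), reflected by `Q3Poly` through the integer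
  recurrence `X₀ = 1, X₁ = t - uv, X_{k+2} = 2(t-uv) X_{k+1} - (1-u²)(1-v²) X_k`; the three-point part is
  `F = F_int/(6·4^Sp)`, `F_int = Σ_k Σ_w sym6(φ_w(u) φ_w(v) Q3 k)` (`FPoly3`; the `6` because the certificates use
  `S_k = sym6(u^i v^j Q3 k)/6`);
* the box multipliers are `(p - qx)(1 + x)` (`ptX3`), nonnegative exactly on `[-1, p/q]` (`q > 0`);
* targets and the numerical bound carry the denominators `6`, `q` and the Legendre scale `2^d`
  (see `targetI3`, `targetII3`, `checkBound3`: identity `(I)` × `6q·2^{S+d}·4^{Sp}·4^{Spp}`, identity `(II)` ×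
  `6q·2^{S}·4^{Sp}·4^{Spp}`, bound `< 13`).
Gram blocks (`GramBlk`, `quadL`, `chunkOK`), the trie normal form, `ofFlat`, `CertPolys`, `p4` are REUSED from
`KissingCertComp` unchanged. The semantics (evaluation lemmas) and the soundness theorem via
`BachocVallentin.card_le_of_certificate3_int` (`ThreePointKernelDimThree`) belong in a sibling `TammesCertDefs`
(not in this file, which — like its template — imports nothing analytic). Data format: «t13-kernelcert/v1»
(pub-crystal3d phase2/sdp-topcut/KERNEL-FORMAT.md).

## References
* C. Bachoc, F. Vallentin, *New upper bounds for kissing numbers from semidefinite programming*,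
  J. Amer. Math. Soc. 21 (2008) 909–924, Theorem 3.2 (n = 3), Theorem 4.2, §5. [`BachocVallentin2007`]
-/

noncomputable section

namespace Summit.Ventures.Crystal3D.TopCut

open Literature.Geometry.DiscreteGeometry Literature.Geometry.DiscreteGeometry.PolyCert Literature.Geometry.DiscreteGeometry.PolyCert.SPoly

open Literature.Geometry.DiscreteGeometry Literature.Geometry.DiscreteGeometry.PolyCert Literature.Geometry.DiscreteGeometry.PolyCert.SPoly
namespace PolyCert.SPoly

/-! ### The three-point kernel of `S²` on term lists -/

/-- First-kind homogeneous Chebyshev recurrence on term lists: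
`X₀ = 1`, `X₁ = Hp`, `X_{k+2} = 2·Hp·X_{k+1} - Dp·X_k` (sorted-normalised at each step). [folklore] -/
def chebThPoly : ℕ → SPoly → SPoly → SPoly
  | 0, _, _ => C 1
  | 1, Hp, _ => Hp
  | k + 2, Hp, Dp => normalize (mulN (smul 2 Hp) (chebThPoly (k + 1) Hp Dp) ++ neg (mulN Dp (chebThPoly k Hp Dp)))

/-- `Q3 k = chebHom k (2(t-uv)) ((1-u²)(1-v²))` as a (sorted, normalised) term list:
`Q3Poly 0 = 1`, `Q3Poly 1 = t - uv`, `Q3Poly 2 = 2(t-uv)² - (1-u²)(1-v²)`, …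
[cite: BachocVallentin2007, Theorem 3.2 (n = 3: the inner kernel is Chebyshev T_k)] -/
def Q3Poly (k : ℕ) : SPoly :=
  normalize (chebThPoly k (T ++ neg (mul U V)) (mul (C 1 ++ neg (mul U U)) (C 1 ++ neg (mul V V))))

/-- `u^a v^b Q3 k` as a term list. [folklore] -/
def baseTab3 (k a b : ℕ) : SPoly := normalize (mulN [(⟨a, b, 0⟩, 1)] (Q3Poly k))

/-- `sym6 (u^a v^b Q3 k)` as a sorted term list. [folklore] -/
def symTab3 (k a b : ℕ) : SPoly :=
  normalize (baseTab3 k a b ++ permBAC (baseTab3 k a b) ++ permACB (baseTab3 k a b) ++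
    permCBA (baseTab3 k a b) ++ permCAB (baseTab3 k a b) ++ permBCA (baseTab3 k a b))

/-- One weight vector of the `S²` three-point part: `Σ_{a,b} (w_a w_b) · symTab3 k a b`. [folklore] -/
def FwPoly3 (k : ℕ) (w : List ℤ) : SPoly :=
  mergeAll ((List.range w.length).map fun a => mergeAll ((List.range w.length).map fun b' =>
    smul (w.getD a 0 * w.getD b' 0) (symTab3 k a b')))

/-- One block. [folklore] -/
def FbPoly3 (b : FBlk) : SPoly := mergeAll (b.ws.map (FwPoly3 b.k))

/-- Reflective form of `F_int = Σ_blocks Σ_w sym6(φ_w(u) φ_w(v) Q3 k)`. [folklore] -/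
def FPoly3 (bs : List FBlk) : SPoly := mergeAll (bs.map FbPoly3)

/-! ### The two-point part (Legendre) and the box multipliers -/

/-- Reflective form of `Ã(u) = Σ_{k=1}^{d} as[k-1] · 2^{d-k} · (2^k P_k)(u) = 2^{S+d} A(u)`. [folklore] -/
def APoly3 (d : ℕ) (as : List ℤ) : SPoly :=
  mergeAll ((List.range as.length).map fun i =>
    smul (as.getD i 0 * 2 ^ (d - (i + 1))) (legendreIPoly (i + 1) U (C 1)))

/-- The box multiplier `(p - qX)(1 + X)` for `X ∈ {u, v, t}`; `≥ 0` exactly on `X ∈ [-1, p/q]`. [folklore] -/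
def ptX3 (p q : ℤ) (X : SPoly) : SPoly := normalize (mul (C p ++ neg (smul q X)) (C 1 ++ X))

/-! ### The certificate record and the checks -/

/-- An `S²` certificate (angle cosine `p/q`, degree `d`, scales, scalars, `F` data, slacks). [folklore] -/
structure Cert3 where
  /-- numerator of the angle cosine `s = p/q` -/
  p : ℤ
  /-- denominator (`> 0`) of the angle cosine -/
  q : ℤ
  /-- degree `d` (= number of `a_k`, and `F` has blocks `k = 0 … d`) -/
  d : ℕ
  /-- binary scale of `a_k`, `b_ij` (`a_k = A[k-1]/2^S`, `b_ij = B_ij/2^S`) -/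
  S : ℕ
  /-- binary scale of the weight vectors of `F` (`F = F_int / (6·4^Sp)`) -/
  Sp : ℕ
  /-- binary scale of the Gram factors (`form = zᵀ(LLᵀ)z / 4^Spp`) -/
  Spp : ℕ
  /-- numerators of `a_1, …, a_d` -/
  A : List ℤ
  /-- numerator of `b₁₁` -/
  B11 : ℤ
  /-- numerator of `b₁₂` -/
  B12 : ℤ
  /-- numerator of `b₂₂` -/
  B22 : ℤ
  /-- the three-point part -/
  F : List FBlk
  /-- slack numerator of `(II')` -/
  c0 : ℕ
  /-- slack numerator of `(I')` -/
  c01 : ℕ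

/-- Semantic validation of an `F` expansion on `S²`: `FPoly3 F - FP` vanishes identically. [folklore] -/
def FexpOK3 (F : List FBlk) (FP : SPoly) : Bool := residualBound (FPoly3 F ++ neg FP) 0

/-- Block-chunk check for `F` on `S²`: `Dprev + FPoly3 bs - Dnext ≡ 0`. [folklore] -/
def FchunkOK3 (bs : List FBlk) (Dprev Dnext : SPoly) : Bool :=
  residualBound (Dprev ++ FPoly3 bs ++ neg Dnext) 0

/-- Target of `(II')`: `-(6q·4^{Sp}·4^{Spp}·B22 + q·2^{S}·4^{Spp}·F_int)`. [folklore] -/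
def targetII3 (c : Cert3) (P : CertPolys) : SPoly :=
  neg (C (6 * c.q * 4 ^ c.Sp * 4 ^ c.Spp * c.B22) ++ smul (c.q * 2 ^ c.S * 4 ^ c.Spp) P.FP)

/-- Sum-of-squares side of `(II')`:
`6q·2^S·4^{Sp}·Rr + 6·2^S·4^{Sp}·Σ_x (p-qx)(1+x)·R_x + 6q·2^S·4^{Sp}·p₄·R4`. [folklore] -/
def rhsII3 (c : Cert3) (P : CertPolys) : SPoly :=
  mergeAll [smul (6 * c.q * 2 ^ c.S * 4 ^ c.Sp) P.Rr,
    smul (6 * 2 ^ c.S * 4 ^ c.Sp) (mulN (ptX3 c.p c.q U) P.Ru),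
    smul (6 * 2 ^ c.S * 4 ^ c.Sp) (mulN (ptX3 c.p c.q V) P.Rv),
    smul (6 * 2 ^ c.S * 4 ^ c.Sp) (mulN (ptX3 c.p c.q T) P.Rt),
    smul (6 * c.q * 2 ^ c.S * 4 ^ c.Sp) (mulN p4 P.R4)]

/-- The check of `(II')`: `|targetII3 - rhsII3 - c0| ≤ c0` coefficientwise-summed. [folklore] -/
def checkII3 (c : Cert3) (P : CertPolys) : Bool :=
  residualBound (mergeAll [targetII3 c P, neg (rhsII3 c P), neg (C c.c0)]) c.c0

/-- Target of `(I')`: `-(D_I + 6q·4^{Sp}·4^{Spp}·Ã(u) + 6q·2^d·4^{Sp}·4^{Spp}·(2B12+B22) + 3q·2^{S+d}·4^{Spp}·F_int(u,u,1))`,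
`D_I = 6q·2^{S+d}·4^{Sp}·4^{Spp}`. [folklore] -/
def targetI3 (c : Cert3) (P : CertPolys) : SPoly :=
  neg (C (6 * c.q * 2 ^ (c.S + c.d) * 4 ^ c.Sp * 4 ^ c.Spp) ++
    smul (6 * c.q * 4 ^ c.Sp * 4 ^ c.Spp) (APoly3 c.d c.A) ++
    C (6 * c.q * 2 ^ c.d * 4 ^ c.Sp * 4 ^ c.Spp * (2 * c.B12 + c.B22)) ++
    smul (3 * c.q * 2 ^ (c.S + c.d) * 4 ^ c.Spp) (substUU1 P.FP))

/-- Sum-of-squares side of `(I')`: `6q·2^{S+d}·4^{Sp}·Qq + 6·2^{S+d}·4^{Sp}·(p-qu)(1+u)·Qq1`. [folklore] -/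
def rhsI3 (c : Cert3) (P : CertPolys) : SPoly :=
  mergeAll [smul (6 * c.q * 2 ^ (c.S + c.d) * 4 ^ c.Sp) P.Qq,
    smul (6 * 2 ^ (c.S + c.d) * 4 ^ c.Sp) (mulN (ptX3 c.p c.q U) P.Qq1)]

/-- The check of `(I')`. [folklore] -/
def checkI3 (c : Cert3) (P : CertPolys) : Bool :=
  residualBound (mergeAll [targetI3 c P, neg (rhsI3 c P), neg (C c.c01)]) c.c01

/-- Side conditions: `q > 0`, scales consistent, `|A| = d`, `a_k ≥ 0`, `b ⪰ 0`. [folklore] -/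
def checkSide3 (c : Cert3) : Bool :=
  decide (0 < c.q) && decide (c.S ≤ 2 * c.Spp) && decide (2 * c.Sp ≤ 2 * c.Spp) && decide (c.A.length = c.d) &&
  decide (c.F.length = c.d + 1) &&
  (c.A.all fun a => decide (0 ≤ a)) &&
  decide (0 ≤ c.B11) && decide (0 < c.B22) && decide (c.B12 * c.B12 ≤ c.B11 * c.B22)

/-- Integer test `0 ≤ 1 + A(1) + b₁₁ + F(1,1,1) < 13` (× `6·2^{S+d}·4^{Sp}`), using the expansion `FP`. [folklore] -/
def checkBound3 (c : Cert3) (P : CertPolys) : Bool :=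
  decide (6 * 2 ^ (c.S + c.d) * 4 ^ c.Sp + 6 * 4 ^ c.Sp * coeffSum (APoly3 c.d c.A) + 6 * 2 ^ c.d * 4 ^ c.Sp * c.B11
      + 2 ^ (c.S + c.d) * coeffSum P.FP < 13 * 6 * 2 ^ (c.S + c.d) * 4 ^ c.Sp) &&
  decide (0 ≤ 6 * 2 ^ (c.S + c.d) * 4 ^ c.Sp + 6 * 4 ^ c.Sp * coeffSum (APoly3 c.d c.A) + 6 * 2 ^ c.d * 4 ^ c.Sp * c.B11
      + 2 ^ (c.S + c.d) * coeffSum P.FP)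

end PolyCert.SPoly

end Summit.Ventures.Crystal3D.TopCut

end
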